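import Literature.Probability.LatticeModels.TwistCorr
import Literature.Probability.LatticeModels.CriticalCorrWellDefined
import HarnessLib

/-!
# The twisted free box: monotone infinite-volume limit by the GKS inequalities

Topic `Literature/Probability/LatticeModels`; companion (b) of the definition request `defn-twistCorr`
of route VolterraWard (`Summits/CriticalPhenomena/Ising3DConformalLimit`, items 7037–7040), for the
objects of `TwistCorr.lean`: the critical Ising correlator `twistCorr N W M A n y` on the twisted free
box `box 3 N` (couplings `twistCouplings N W M A`, Newman's pair-interaction average `PairIsing.avg`)
and its `ε`-odd response `twistOddResponse`.

The couplings `twistCouplings N W M A ≥ 0` are FERROMAGNETIC and the boundary condition is FREE, so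
the two Griffiths (GKS) inequalities give, exactly as for the plain free box (Friedli–Velenik 2017,
Exercise 3.12, p. 112, and Exercise 3.16, p. 115), that `N ↦ twistCorr N W M A n y` is NONDECREASING
(enlarging the box only ADDS nonnegative couplings: the smaller box is the larger one with the
couplings across its boundary switched off, and switched-off spins are independent fair coins that
cancel in the Gibbs ratio), bounded by `1`, hence CONVERGENT as `N → ∞`; the limit is
`twistCorrLim W M A n y` (a `limUnder`, like the tree's `freeExpect` / `plusExpect`).

## Contents (all proved)

* `PairIsing.avg_comp_eq_avg_of_vanish` — DECOUPLING: if the couplings on `κ` vanish as soon as one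
  index is off the range of an injection `e : ι → κ`, the average of an observable of the `ι`-spins is
  the average for the pulled-back couplings on `ι` (`PairIsing.weight_eq_weight_comp_of_vanish`).
* `PairIsing.avg_spinProduct_mono` — GRIFFITHS' COMPARISON `|c'| ≤ c ⇒ ⟨σ_B⟩_{c'} ≤ ⟨σ_B⟩_c`
  (the tree's `gksExpect_mono_of_abs_le` through `PairIsing.avg_eq_gksExpect`).
* `twistCorr_mono` — `Monotone fun N => twistCorr N W M A n y` (for EVERY `y`: before all insertions
  are inside the box the value is `0 ≤ ·` by GKS I, `twistCorr_nonneg`).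
* `twistCorrLim`, `tendsto_twistCorr` (the box limit exists), `twistCorrLim_eq_iSup`,
  `twistCorr_le_twistCorrLim`, `twistCorrLim_nonneg`, `twistCorrLim_le_one`,
  `tendsto_twistOddResponse`; `twistCorrLim_zero_right` / `tendsto_isingExpect_free_spinMonomial`:
  for `M = 0` the limit is the free state `⟨∏ᵢ σ_{yᵢ}⟩^∅_{β_c(3),0}` of `ℤ³` (`freeExpect`), whose
  box sequence therefore converges for spin MONOMIALS (cf. `hasBoxLimit_isingCorr_free_holds` for
  spin products); and `twistCorrLim_zero_right_eq_criticalCorr` / `tendsto_twistCorr_zero_right`: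
  it IS the critical correlator `criticalCorr 3 n y = ⟨∏ᵢ σ_{yᵢ}⟩⁺_{β_c(3),0}` of the route's cruxes
  (free = plus at `β_c(3)`, `d = 3`: the tree's `criticalCorr_wellDefined_holds`, after
  Aizenman–Duminil-Copin–Sidoravicius 2015).

## References

* S. Friedli, Y. Velenik, *Statistical Mechanics of Lattice Systems*, CUP (2017), §3.6–3.8:
  Thm. 3.49 (GKS), Exercise 3.31 p. 142 (comparison of couplings), Exercise 3.12 p. 112 and
  Exercise 3.16 p. 115 (monotonicity in the volume and the free-state limit) [FriedliVelenik2017].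
* R. B. Griffiths, J. Math. Phys. 8 (1967) 478–483, 484–489 (the original inequalities and the
  monotone infinite-volume limit for free boundary conditions) — as presented in [FriedliVelenik2017].
* M. Aizenman, H. Duminil-Copin, V. Sidoravicius, Comm. Math. Phys. 334 (2015) 719–742, Thm. 1.2
  (continuity of the magnetisation at `β_c`, `d ≥ 3`) [AizenmanDuminilCopinSidoraviciusCMP2015] —
  used only through the tree's `criticalCorr_wellDefined_holds`.
* Route `CriticalPhenomena/VolterraWard` (the objects; limit order "… then N large").

## Design / not here

No new named facts. Not here: the `N → ∞` limit of TWISTED (`M ≠ 0`) boxes versus any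
infinite-volume state of the twisted crystal beyond its existence (`twistCorrLim`), and the
bicrystal form of the transport identity (companion (c), `TwistBicrystal.lean`).
-/

noncomputable section

open Finset Filter
open scoped Topology

namespace Literature.Probability.LatticeModels

/-! ### Two general facts about Newman's pair-interaction average -/

namespace PairIsing

variable {ι κ : Type*} [Fintype ι] [DecidableEq ι] [Fintype κ] [DecidableEq κ]

omit [DecidableEq ι] in
/-- A sum over `κ` of a function vanishing off the range of an injection `e : ι → κ` is the sum over
`ι` of its values on the range. [folklore] -/
theorem sum_eq_sum_comp_of_vanish {e : ι → κ} (he : Function.Injective e) {g : κ → ℝ}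
    (hg : ∀ a, a ∉ Set.range e → g a = 0) : ∑ a, g a = ∑ i, g (e i) := by
  have h1 : ∑ i, g (e i) = ∑ a ∈ univ.image e, g a :=
    (Finset.sum_image fun i _ j _ h => he h).symm
  rw [h1]
  refine (Finset.sum_subset (Finset.subset_univ _) fun a _ ha => hg a ?_).symm
  rintro ⟨i, rfl⟩
  exact ha (Finset.mem_image_of_mem e (Finset.mem_univ i))

omit [DecidableEq ι] in
/-- If the couplings `c` on `κ` vanish as soon as one index is off the range of the injection
`e : ι → κ`, the Boltzmann weight of `s : SpinConfig κ` is the weight of the restricted configuration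
`s ∘ e` for the pulled-back couplings (the spins off the range do not interact).
[cite: FriedliVelenik2017, Exercise 3.12, p. 112] -/
theorem weight_eq_weight_comp_of_vanish {e : ι → κ} (he : Function.Injective e) {c : κ → κ → ℝ}
    (hc : ∀ a b, (a ∉ Set.range e ∨ b ∉ Set.range e) → c a b = 0) (s : SpinConfig κ) :
    weight c s = weight (fun i j => c (e i) (e j)) (s ∘ e) := by
  rw [weight, weight]
  congr 1
  have inner : ∀ a, ∑ b, c a b * (spinAt a s * spinAt b s) =
      ∑ j, c a (e j) * (spinAt a s * spinAt (e j) s) := fun a =>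
    sum_eq_sum_comp_of_vanish he fun b hb => by rw [hc a b (Or.inr hb), zero_mul]
  simp_rw [inner]
  rw [sum_eq_sum_comp_of_vanish (g := fun a => ∑ j, c a (e j) * (spinAt a s * spinAt (e j) s)) he
    fun a ha => Finset.sum_eq_zero fun j _ => by rw [hc a (e j) (Or.inl ha), zero_mul]]
  rfl

/-- **Decoupling (restriction to a sub-system).** If the couplings `c` on the finite set `κ` vanish
as soon as one index is off the range of the injection `e : ι → κ`, then the `c`-average of any
observable of the `ι`-spins, read through `e`, is the average for the pulled-back couplings on `ι`:
the spins off the range are independent fair coins and cancel in the Gibbs ratio (the `s = 0` end of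
Friedli–Velenik's Exercise 3.12). [cite: FriedliVelenik2017, Exercise 3.12, p. 112] -/
theorem avg_comp_eq_avg_of_vanish {e : ι → κ} (he : Function.Injective e) {c : κ → κ → ℝ}
    (hc : ∀ a b, (a ∉ Set.range e ∨ b ∉ Set.range e) → c a b = 0) (f : SpinConfig ι → ℝ) :
    avg c (fun s => f (s ∘ e)) = avg (fun i j => c (e i) (e j)) f := by
  obtain ⟨m, hm, hsum⟩ := exists_sum_comp_eq_smul ℤˣ e he
  rw [avg_def, avg_def]
  simp_rw [weight_eq_weight_comp_of_vanish he hc]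
  rw [hsum (fun t => f t * weight (fun i j => c (e i) (e j)) t),
    hsum (fun t => weight (fun i j => c (e i) (e j)) t), nsmul_eq_mul, nsmul_eq_mul,
    mul_div_mul_left _ _ (by positivity)]

/-- **Griffiths' comparison of pair couplings**: if `|c'_{ab}| ≤ c_{ab}` for all `a, b`, then
`⟨σ_B⟩_{c'} ≤ ⟨σ_B⟩_{c}` for every finite `B` (Friedli–Velenik 2017, Exercise 3.31, through
`avg_eq_gksExpect` and the tree's `gksExpect_mono_of_abs_le`). [cite: FriedliVelenik2017, Exercise 3.31, p. 142] -/
theorem avg_spinProduct_mono {c c' : ι → ι → ℝ} (h : ∀ a b, |c' a b| ≤ c a b) (B : Finset ι) :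
    avg c' (spinProduct B) ≤ avg c (spinProduct B) := by
  classical
  rw [avg_eq_gksExpect, avg_eq_gksExpect]
  exact gksExpect_mono_of_abs_le _ _ (fun p _ => h p.1 p.2) B

end PairIsing

/-! ### Monotonicity of the twisted correlator in the box -/

section Volume

variable (W : ℕ) (M A : ℤ) (n : ℕ) (y : Fin n → Site 3)

/-- Inside the box the observable of `twistCorr` is the spin monomial of the insertion sites.
[folklore] -/
theorem twistObs_eq_spinMonomial {N : ℕ} (hy : ∀ i, y i ∈ box 3 N) :
    (fun s : SpinConfig ↥(box 3 N) =>
        ∏ i, (if h : y i ∈ box 3 N then spinAt (⟨y i, h⟩ : ↥(box 3 N)) s else 0)) =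
      spinMonomial fun i => (⟨y i, hy i⟩ : ↥(box 3 N)) := by
  funext s
  unfold spinMonomial
  exact Finset.prod_congr rfl fun i _ => by rw [dif_pos (hy i)]

/-- **GKS monotonicity of the twisted correlator in the volume**: for every block `W`, Burgers
number `M`, wall height `A` and insertion sites `y`, `N ↦ twistCorr N W M A n y` is nondecreasing.
While some insertion is outside `box 3 N` the value is `0 ≤ twistCorr N' …` (GKS I); once all are
inside, `box 3 N ⊆ box 3 N'` carries the SAME couplings on the pairs of the small box
(`twistCouplings` only reads the sites), the small box is the large one with all other couplings
switched off (`PairIsing.avg_comp_eq_avg_of_vanish`), and switching nonnegative couplings back on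
increases spin-product expectations (GKS II / Griffiths' comparison, `PairIsing.avg_spinProduct_mono`)
— Friedli–Velenik 2017, Exercise 3.12, verbatim for the twisted graph.
[cite: FriedliVelenik2017, Exercise 3.12, p. 112] -/
theorem twistCorr_mono : Monotone fun N => twistCorr N W M A n y := by
  intro N N' hNN'
  dsimp only
  by_cases hy : ∀ i, y i ∈ box 3 N
  swap
  · obtain ⟨i, hi⟩ := not_forall.1 hy
    rw [twistCorr_eq_zero_of_not_mem W M A hi]
    exact twistCorr_nonneg _ _ _ _ _ _
  have hsub : box 3 N ⊆ box 3 N' := box_mono 3 hNN'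
  have hy' : ∀ i, y i ∈ box 3 N' := fun i => hsub (hy i)
  -- the inclusion of the small box into the large one (`volIncl` of `GKSInequalities`)
  let e : ↥(box 3 N) → ↥(box 3 N') := volIncl hsub
  have he : Function.Injective e := volIncl_injective hsub
  have hrange : ∀ z : ↥(box 3 N'), z ∉ Set.range e → z.1 ∉ box 3 N :=
    fun z hz hmem => hz ⟨⟨z.1, hmem⟩, rfl⟩
  -- the couplings of the large box with everything off the small box switched off
  let c' : ↥(box 3 N') → ↥(box 3 N') → ℝ := fun a b =>
    if a.1 ∈ box 3 N ∧ b.1 ∈ box 3 N then twistCouplings N' W M A a b else 0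
  -- `twistCouplings` only reads the underlying sites
  have hsame : ∀ a b : ↥(box 3 N),
      twistCouplings N' W M A (e a) (e b) = twistCouplings N W M A a b := by
    intro a b
    rw [twistCouplings_eq_ite, twistCouplings_eq_ite]
    rfl
  have hpull : (fun a b => c' (e a) (e b)) = twistCouplings N W M A := by
    funext a b
    rw [← hsame a b]
    exact if_pos ⟨a.2, b.2⟩
  have hvan : ∀ a b, (a ∉ Set.range e ∨ b ∉ Set.range e) → c' a b = 0 := by
    intro a b hab
    show (if a.1 ∈ box 3 N ∧ b.1 ∈ box 3 N then twistCouplings N' W M A a b else 0) = 0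
    split_ifs with h
    · rcases hab with h' | h'
      · exact (hrange a h' h.1).elim
      · exact (hrange b h' h.2).elim
    · rfl
  have hcmp : ∀ a b, |c' a b| ≤ twistCouplings N' W M A a b := by
    intro a b
    show |(if a.1 ∈ box 3 N ∧ b.1 ∈ box 3 N then twistCouplings N' W M A a b else 0)| ≤ _
    split_ifs
    · exact (abs_of_nonneg (twistCouplings_nonneg _ _ _ _ _ _)).le
    · rw [abs_zero]; exact twistCouplings_nonneg _ _ _ _ _ _
  -- the observables: the monomial of the large box restricts to the monomial of the small box
  have hobs : ∀ s : SpinConfig ↥(box 3 N'),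
      (∏ i, (if h : y i ∈ box 3 N then spinAt (⟨y i, h⟩ : ↥(box 3 N)) (s ∘ e) else 0)) =
        ∏ i, (if h : y i ∈ box 3 N' then spinAt (⟨y i, h⟩ : ↥(box 3 N')) s else 0) := by
    intro s
    refine Finset.prod_congr rfl fun i _ => ?_
    rw [dif_pos (hy i), dif_pos (hy' i)]
    rfl
  obtain ⟨B, hB⟩ := exists_spinMonomial_eq_spinProduct fun i => (⟨y i, hy' i⟩ : ↥(box 3 N'))
  have hobs' : (fun s : SpinConfig ↥(box 3 N') =>
      ∏ i, (if h : y i ∈ box 3 N' then spinAt (⟨y i, h⟩ : ↥(box 3 N')) s else 0)) = spinProduct B := by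
    rw [twistObs_eq_spinMonomial n y hy', hB]
  calc twistCorr N W M A n y
      = PairIsing.avg (fun a b => c' (e a) (e b))
          (fun s => ∏ i, (if h : y i ∈ box 3 N then spinAt (⟨y i, h⟩ : ↥(box 3 N)) s else 0)) := by
        rw [hpull, twistCorr]
    _ = PairIsing.avg c' (fun s => ∏ i,
          (if h : y i ∈ box 3 N then spinAt (⟨y i, h⟩ : ↥(box 3 N)) (s ∘ e) else 0)) :=
        (PairIsing.avg_comp_eq_avg_of_vanish he hvan _).symm
    _ = PairIsing.avg c' (spinProduct B) := by
        rw [← hobs']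
        exact congrArg _ (funext hobs)
    _ ≤ PairIsing.avg (twistCouplings N' W M A) (spinProduct B) := PairIsing.avg_spinProduct_mono hcmp B
    _ = twistCorr N' W M A n y := by rw [twistCorr, hobs']

/-- `twistCorr ≤ 1`. [folklore] -/
theorem twistCorr_le_one (N : ℕ) : twistCorr N W M A n y ≤ 1 :=
  (le_abs_self _).trans (abs_twistCorr_le_one N W M A n y)

/-- The box sequence of the twisted correlator is bounded above (by `1`). [folklore] -/
theorem bddAbove_range_twistCorr : BddAbove (Set.range fun N => twistCorr N W M A n y) := by
  refine ⟨1, ?_⟩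
  rintro _ ⟨N, rfl⟩
  exact twistCorr_le_one W M A n y N

/-! ### The infinite-volume twisted correlator -/

/-- The **infinite-volume critical correlator of the twisted crystal** with free boundary
conditions, `lim_{N → ∞} twistCorr N W M A n y` (a `limUnder` along the boxes `box 3 N`, like the
tree's `freeExpect`; by `tendsto_twistCorr` it IS the limit, and by `twistCorrLim_eq_iSup` the
supremum, of the nondecreasing box sequence). [cite: FriedliVelenik2017, Exercise 3.16, p. 115] -/
def twistCorrLim (W : ℕ) (M A : ℤ) (n : ℕ) (y : Fin n → Site 3) : ℝ :=
  limUnder atTop fun N : ℕ => twistCorr N W M A n y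

/-- The box sequence converges to its supremum (monotone and bounded). [cite: FriedliVelenik2017, Exercise 3.16, p. 115] -/
theorem tendsto_twistCorr_ciSup :
    Tendsto (fun N => twistCorr N W M A n y) atTop (𝓝 (⨆ N, twistCorr N W M A n y)) :=
  tendsto_atTop_ciSup (twistCorr_mono W M A n y) (bddAbove_range_twistCorr W M A n y)

/-- `twistCorrLim` is the supremum of the box sequence. [cite: FriedliVelenik2017, Exercise 3.16, p. 115] -/
theorem twistCorrLim_eq_iSup : twistCorrLim W M A n y = ⨆ N, twistCorr N W M A n y :=
  (tendsto_twistCorr_ciSup W M A n y).limUnder_eq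

/-- **Existence of the infinite-volume limit of the twisted free box** (GKS):
`twistCorr N W M A n y → twistCorrLim W M A n y` as `N → ∞`, for every `W, M, A, n, y`.
[cite: FriedliVelenik2017, Exercise 3.16, p. 115] -/
theorem tendsto_twistCorr :
    Tendsto (fun N => twistCorr N W M A n y) atTop (𝓝 (twistCorrLim W M A n y)) := by
  rw [twistCorrLim_eq_iSup]
  exact tendsto_twistCorr_ciSup W M A n y

/-- Finite-volume twisted correlators are bounded by their infinite-volume limit (monotone limit).
[cite: FriedliVelenik2017, Exercise 3.12, p. 112] -/
theorem twistCorr_le_twistCorrLim (N : ℕ) : twistCorr N W M A n y ≤ twistCorrLim W M A n y :=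
  (twistCorr_mono W M A n y).ge_of_tendsto (tendsto_twistCorr W M A n y) N

/-- `0 ≤ twistCorrLim` (GKS I in the limit). [cite: FriedliVelenik2017, Thm. 3.49, eq. (3.54)] -/
theorem twistCorrLim_nonneg : 0 ≤ twistCorrLim W M A n y :=
  (twistCorr_nonneg 0 W M A n y).trans (twistCorr_le_twistCorrLim W M A n y 0)

/-- `twistCorrLim ≤ 1`. [folklore] -/
theorem twistCorrLim_le_one : twistCorrLim W M A n y ≤ 1 :=
  le_of_tendsto' (tendsto_twistCorr W M A n y) (twistCorr_le_one W M A n y)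

/-- The `ε`-odd response converges as `N → ∞`, to the difference of the limits at `M` and `−M`.
[folklore] -/
theorem tendsto_twistOddResponse :
    Tendsto (fun N => twistOddResponse N W M A n y) atTop
      (𝓝 (twistCorrLim W M A n y - twistCorrLim W (-M) A n y)) :=
  (tendsto_twistCorr W M A n y).sub (tendsto_twistCorr W (-M) A n y)

/-- The insertion sites lie in all large boxes. [folklore] -/
theorem eventually_forall_insertion_mem_box : ∀ᶠ N : ℕ in atTop, ∀ i, y i ∈ box 3 N := by
  obtain ⟨L₀, hL₀⟩ := exists_forall_subset_box 3 (Finset.univ.image y)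
  exact eventually_atTop.2 ⟨L₀, fun N hN i => hL₀ N hN (Finset.mem_image_of_mem y (Finset.mem_univ i))⟩

/-- For `M = 0` the box sequence of the twisted correlator is eventually the box sequence
`⟨∏ᵢ σ_{yᵢ}⟩^∅_{box 3 N; β_c(3), 0}` of the plain free box (`twistCorr_zero_right`). [cite: FriedliVelenik2017, §3.1, eq. (3.8)] -/
theorem twistCorr_zero_right_eventuallyEq (A : ℤ) :
    (fun N : ℕ => twistCorr N W 0 A n y) =ᶠ[atTop]
      fun N : ℕ => isingExpect (zdGraph 3) (box 3 N) (criticalBeta 3) 0 .free (spinMonomial y) :=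
  (eventually_forall_insertion_mem_box n y).mono fun _ hN => twistCorr_zero_right W A hN

/-- **No twist: the limit is the free state of `ℤ³` at `β_c(3)`**, `twistCorrLim W 0 A n y =
⟨∏ᵢ σ_{yᵢ}⟩^∅_{β_c(3),0}` (`freeExpect`; both sides are `limUnder`s of eventually equal sequences,
so no convergence input is needed). [cite: FriedliVelenik2017, §3.6, Exercise 3.16] -/
theorem twistCorrLim_zero_right (A : ℤ) :
    twistCorrLim W 0 A n y = freeExpect 3 (criticalBeta 3) 0 (spinMonomial y) := by
  unfold twistCorrLim freeExpect limUnder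
  rw [Filter.map_congr (twistCorr_zero_right_eventuallyEq W n y A)]

/-- Consequently the free-box critical expectations of a spin MONOMIAL converge:
`⟨∏ᵢ σ_{yᵢ}⟩^∅_{box 3 N; β_c(3), 0} → ⟨∏ᵢ σ_{yᵢ}⟩^∅_{β_c(3),0}` (the tree's
`hasBoxLimit_isingCorr_free_holds` is the spin-product case). [cite: FriedliVelenik2017, Exercise 3.16, p. 115] -/
theorem tendsto_isingExpect_free_spinMonomial :
    Tendsto (fun N : ℕ => isingExpect (zdGraph 3) (box 3 N) (criticalBeta 3) 0 .free (spinMonomial y))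
      atTop (𝓝 (freeExpect 3 (criticalBeta 3) 0 (spinMonomial y))) := by
  rw [← twistCorrLim_zero_right 0 n y 0]
  exact (tendsto_twistCorr 0 0 0 n y).congr' (twistCorr_zero_right_eventuallyEq 0 n y 0)

/-- **No twist: the limit is the critical correlator `⟨∏ᵢ σ_{yᵢ}⟩⁺_{β_c(3),0}` of `ℤ³`.** At
`β_c(3)` the free and plus states coincide (continuity of the magnetisation at `β_c` for `d ≥ 3`,
Aizenman–Duminil-Copin–Sidoravicius 2015, in tree as `criticalCorr_wellDefined_holds`: the
free-box expectations of spin monomials converge to `criticalCorr`), so the untwisted box limit is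
the `criticalCorr 3` that the cruxes of route VolterraWard compare with (companion (d) of the
request, for the plain box). [cite: AizenmanDuminilCopinSidoraviciusCMP2015, Thm. 1.2 with Cor. 1.5 (1)] -/
theorem twistCorrLim_zero_right_eq_criticalCorr (A : ℤ) : twistCorrLim W 0 A n y = criticalCorr 3 n y := by
  have h := criticalCorr_wellDefined_holds (d := 3) le_rfl n y .free (by simp)
  rw [twistCorrLim_zero_right]
  exact tendsto_nhds_unique (tendsto_isingExpect_free_spinMonomial n y) h

/-- Hence the untwisted free box converges to the critical correlator:
`twistCorr N W 0 A n y → criticalCorr 3 n y` as `N → ∞`. [cite: AizenmanDuminilCopinSidoraviciusCMP2015, Thm. 1.2 with Cor. 1.5 (1)] -/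
theorem tendsto_twistCorr_zero_right (A : ℤ) :
    Tendsto (fun N => twistCorr N W 0 A n y) atTop (𝓝 (criticalCorr 3 n y)) := by
  rw [← twistCorrLim_zero_right_eq_criticalCorr W n y A]
  exact tendsto_twistCorr W 0 A n y

end Volume

end Literature.Probability.LatticeModels

end
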